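import Summits.QuantumFields.YangMills.Theorems.RecentredCoverTransferNearDiagonalVanishingTorus
import Summits.QuantumFields.YangMills.Theorems.RecentredCoverTransferCoverRecentringOfRate
import HarnessLib

/-!
# Route `RecentredCoverTransfer` (LINE g9-B′, planner ym-idea-1 g9), crux `NearDiagonalVanishing` (stmt-QuantumFields-23257) —
# III: the COVER HALF from `OnePointRate` and `CoverMomentBounds6`; `NearDiagonalVanishing ⇐ OnePointRate ∧ CoverMomentBounds6`

Part II (`…NearDiagonalVanishingTorus`) proved the torus clause of `NearDiagonalVanishing` and reduced the item to its cover clause.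
Here the cover clause is derived from the two OPEN children of `CoverRecentring` — the one scalar `OnePointRate` (23142:
`a_k⁻⁴(m_T(k) − m_C(k)) → 0`) and the UV ceilings on the checkerboard cells `CoverMomentBounds6` (23143) — exactly as the landed glue
`coverRecentringOfRate` (23144, seat ym-line-sfw-p2-w3) does for `CoverRecentring`:

* §1 `cover_pointwise_le` — at one lattice (`0 < a ≤ min 1 ℓ₄`, `L ≥ 14`, `L ≥ a⁻²`, cell strings ceiling, `a⁻⁴|m_C − m| ≤ 1`, support in
  `box(L/2)`): `|∫∏ᵢ(d(τ_{xᵢ}Ũ) − m) dμ_C|·‖F(a x)‖ ≤ 2ⁿ·K_wⁿ·2^{6n}·S(F)·a^{4n}` at EVERY multi-site — recentring expansion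
  `∏(dᵢ − m) = Σ_S (m_C − m)^{n−|S|} ∏_{i∈S}(dᵢ − m_C)` (`moment_eq_sum_powerset`), w3's weights `V_S = (a⁴)^{n−|S|}·W^S·1_{box(L/2)ⁿ}`
  with their sup / collar bounds (`abs_partialMoment_le_pow`, `abs_partialMoment_le_of_strings`), and the tree's abstract-weights
  pointwise bound `OSLegsFromFemtoAndGap.abs_weight_mul_norm_le_prod` (toolkit X-b, flat decay of `⁰𝒮` near the diagonal);
* §2 `cover_near_sum_le` — part I's count `NearDiagonal.near_sum_le` turns it into `≤ B·n²·(2K_F+1)^{4(n−1)}·(3δ)⁴`;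
* §3 ★ `cover_nearDiagonal_eventually` — the cover clause along the leg scheme (`OnePointRate` ⇒ `a_k⁻⁴|δ_k| ≤ 1` eventually,
  `CoverMomentBounds6` on `C_k`, `a_k ≤ ℓ₄`, `β_k ≥ β₄`, compact support ⇒ both support conditions eventually);
* §4 ★ `nearDiagonalVanishing_of_rate : OnePointRate → CoverMomentBounds6 → NearDiagonalVanishing` (by part II's reduction).

Width seat ym-line-sfw-p2-w2 g23 (cell ym-idea-1; free hands), `--supports stmt-QuantumFields-23257`.  THEOREMS ONLY.  HONEST FRAMING:
`OnePointRate` (XL-IR) and `CoverMomentBounds6` (Bałaban ceilings on skew cells) are OPEN, so 23257 closes only CONDITIONALLY on them (the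
item is thereby no harder than 23142 ∧ 23143); no crux, no rung (R2d ROT is a RECORD rung) and no summit is proved; the Yang–Mills mass gap
is NOT proved by any of this.
-/

set_option autoImplicit false

noncomputable section

open scoped SchwartzMap BigOperators ENNReal
open MeasureTheory Filter Topology
open Literature.MathematicalPhysics.QuantumFieldTheory Literature.MathematicalPhysics.QuantumLattice
open Literature.MathematicalPhysics.AQFT
open Literature.Probability.LatticeModels (Site box mem_box)
open Summit.QuantumFields.YangMills.Theorems.ROT (PeriodCell)
open Summit.QuantumFields.YangMills.Theorems.OSLegsFromFemtoAndGap (abs_weight_mul_norm_le_prod mul_norm_le_norm_smul_siteToE)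
open Summit.QuantumFields.YangMills.Theorems.InfiniteVolume (stateMomentStr)
open Summit.QuantumFields.YangMills.Theorems.RecentredCoverTransfer (box_half_subset valMinAbs_sub_eq_of_mem_box_half
  eventually_apply_eq_zero_of_not_mem_box moment_eq_sum_powerset abs_partialMoment_le_pow abs_partialMoment_le_of_strings)

namespace Summit.QuantumFields.YangMills.Theorems.RecentredCoverTransfer.NearDiagonal

variable {G : Type} [Group G] [TopologicalSpace G] [IsTopologicalGroup G] [CompactSpace G]
  [MeasurableSpace G] [BorelSpace G]

/-! ## §1 The cover moment at one lattice: a pointwise `O(a^{4n})` bound -/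

/-- **Pointwise dimension-4 bound for the cell moments centred near the cell mean.**  See the module docstring, §1. [folklore] -/
theorem cover_pointwise_le (Ce : PeriodCell 4) (r : LatticeRep G) (β : ℝ) {C₀ ℓ₄ B a m : ℝ} {L n : ℕ}
    (hℓ : 0 < ℓ₄) (hC₀ : 0 ≤ C₀) (hB : ∀ V, |r.curvature.F V| ≤ B)
    (ha : 0 < a) (ha1 : a ≤ 1) (haℓ : a ≤ ℓ₄) (hL14 : 14 ≤ L) (hLa : a⁻¹ * a⁻¹ ≤ L) (hn : 2 ≤ n)
    (H : ∀ (m' : ℕ) (q : Fin m' → Fin 4 × Fin 4) (y : Fin m' → Site 4) (R : ℕ), (∀ j, (q j).1 < (q j).2) → 1 ≤ R →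
      (R : ℝ) * a ≤ ℓ₄ → 4 * R + 8 ≤ L → (∀ j, y j ∈ box 4 (L / 2)) →
      (∀ j j' : Fin m', j ≠ j' → ∃ k : Fin 4, (2 * (R : ℤ) + 4) ≤ |y j k - y j' k|) →
      |stateMomentStr G r (Measure.map Ce.lift (Ce.measure r.ρ β)) m' q y| ≤ (C₀ / (R : ℝ) ^ 4) ^ m')
    (F : 𝓢((Fin n → EuclideanSpace ℝ (Fin 4)), ℂ)) (hF : IsOffDiagonal F)
    (hsupp : ∀ x : Fin n → Site 4, (∃ i, x i ∉ box 4 (L / 2)) → F (fun i => a • siteToE (x i)) = 0)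
    (hδ : a⁻¹ ^ 4 * |Ce.mean r.ρ β r.curvature.F - m| ≤ 1) (x : Fin n → Site 4) :
    |Ce.moment r.ρ β r.curvature.F m x| * ‖F (fun i => a • siteToE (x i))‖ ≤
      2 ^ n * (((2 * B + 1) * 4 ^ 4 * 5 ^ 6 + (2 * B + 1) * 2 ^ 6 * (10 + 2 * 0) ^ 4 +
            16 * (6 * C₀ + ℓ₄ ^ 4) * 2 ^ 6 * (2 / ℓ₄ + 48) ^ 4) ^ n *
          (SchwartzMap.seminorm ℂ 0 (4 * n) F + SchwartzMap.seminorm ℂ (6 * n) (4 * n) F +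
            SchwartzMap.seminorm ℂ 0 0 F + SchwartzMap.seminorm ℂ (6 * n) 0 F + SchwartzMap.seminorm ℂ (10 * n) 0 F) *
          (2 ^ 6) ^ n) * a ^ (4 * n) := by
  classical
  set μC := Ce.mean r.ρ β r.curvature.F with hμC
  set Kw : ℝ := (2 * B + 1) * 4 ^ 4 * 5 ^ 6 + (2 * B + 1) * 2 ^ 6 * (10 + 2 * 0) ^ 4 +
    16 * (6 * C₀ + ℓ₄ ^ 4) * 2 ^ 6 * (2 / ℓ₄ + 48) ^ 4 with hKw
  set Ssum : ℝ := SchwartzMap.seminorm ℂ 0 (4 * n) F + SchwartzMap.seminorm ℂ (6 * n) (4 * n) F +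
    SchwartzMap.seminorm ℂ 0 0 F + SchwartzMap.seminorm ℂ (6 * n) 0 F + SchwartzMap.seminorm ℂ (10 * n) 0 F with hSsum
  have hB0 : 0 ≤ B := (abs_nonneg _).trans (hB 1)
  have hKw0 : 0 ≤ Kw := by rw [hKw]; positivity
  have hSsum0 : 0 ≤ Ssum := by rw [hSsum]; positivity
  have ha4 : 0 < a ^ 4 := by positivity
  have ha41 : a ^ 4 ≤ 1 := pow_le_one₀ ha.le ha1
  have hRHS0 : 0 ≤ 2 ^ n * (Kw ^ n * Ssum * (2 ^ 6) ^ n) * a ^ (4 * n) := by positivity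
  -- outside `box(L/2)ⁿ` the test function vanishes
  by_cases hx : x ∈ Fintype.piFinset (fun _ : Fin n => box 4 (L / 2))
  swap
  · have h0 : F (fun i => a • siteToE (x i)) = 0 := by
      refine hsupp x ?_
      by_contra h
      push Not at h
      exact hx (Fintype.mem_piFinset.2 h)
    rw [h0, norm_zero, mul_zero]
    exact hRHS0
  have hxb : ∀ i, x i ∈ box 4 (L / 2) := Fintype.mem_piFinset.1 hx
  -- the partial moments and their weights
  set W : Finset (Fin n) → ℝ := fun S =>
    ∫ U, ∏ i ∈ S, (r.curvature.F (configShift (-(x i)) (Ce.lift U)) - μC) ∂(Ce.measure r.ρ β) with hW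
  -- recentring expansion
  have hexp : Ce.moment r.ρ β r.curvature.F m x =
      ∑ S ∈ (Finset.univ : Finset (Fin n)).powerset, (μC - m) ^ (n - S.card) * W S :=
    moment_eq_sum_powerset Ce r.ρ r.continuous β r.curvature.measurable hB m μC x
  -- each `S`-term is `O(a^{4n})` pointwise
  have hterm : ∀ S ∈ (Finset.univ : Finset (Fin n)).powerset,
      |(μC - m) ^ (n - S.card) * W S| * ‖F (fun i => a • siteToE (x i))‖ ≤ Kw ^ n * Ssum * (2 ^ 6) ^ n * a ^ (4 * n) := by
    intro S _
    have hS : S.card ≤ n := by simpa using Finset.card_le_univ S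
    -- w3's weight `V_S` (as a function of the multi-site), its sup and collar bounds
    set V : (Fin n → Site 4) → ℝ := fun z =>
      (a ^ 4) ^ (n - S.card) *
        (∫ U, ∏ i ∈ S, (r.curvature.F (configShift (-(z i)) (Ce.lift U)) - μC) ∂(Ce.measure r.ρ β)) *
        (if z ∈ Fintype.piFinset (fun _ : Fin n => box 4 (L / 2)) then 1 else 0) with hV
    have hM : (0 : ℝ) ≤ 2 * B + 1 := by positivity
    have hCw : (0 : ℝ) ≤ 6 * C₀ + ℓ₄ ^ 4 := by positivity
    have hWabs : ∀ z : Fin n → Site 4,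
        |∫ U, ∏ i ∈ S, (r.curvature.F (configShift (-(z i)) (Ce.lift U)) - μC) ∂(Ce.measure r.ρ β)| ≤ (2 * B) ^ S.card :=
      fun z => abs_partialMoment_le_pow Ce r β hB S z
    have hVsup : ∀ z, |V z| ≤ (2 * B + 1) ^ n := fun z => by
      have h1 : |V z| ≤ |∫ U, ∏ i ∈ S, (r.curvature.F (configShift (-(z i)) (Ce.lift U)) - μC) ∂(Ce.measure r.ρ β)| := by
        simp only [hV]
        split_ifs
        · rw [mul_one, abs_mul, abs_of_pos (pow_pos ha4 _)]
          exact mul_le_of_le_one_left (abs_nonneg _) (pow_le_one₀ ha4.le ha41)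
        · rw [mul_zero, abs_zero]; exact abs_nonneg _
      refine h1.trans ((hWabs z).trans ?_)
      calc (2 * B) ^ S.card ≤ (2 * B + 1) ^ S.card := pow_le_pow_left₀ (by positivity) (by linarith) _
        _ ≤ (2 * B + 1) ^ n := pow_le_pow_right₀ (by linarith) hS
    have hVcol : ∀ (z : Fin n → Site 4) (R : ℕ), 1 ≤ R → (R : ℝ) * a ≤ ℓ₄ → 4 * R + 8 ≤ L →
        (∀ i j : Fin n, i ≠ j → ∃ k : Fin 4,
          (2 * (R : ℤ) + 4) ≤ |((((z i k - z j k : ℤ) : ZMod (2 * L + 1))).valMinAbs : ℤ)|) →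
        |V z| ≤ ((6 * C₀ + ℓ₄ ^ 4) / (R : ℝ) ^ 4) ^ n := by
      intro z R hR hRa hRL hsep
      have hR0 : (0 : ℝ) < R := by exact_mod_cast hR
      by_cases hz : z ∈ Fintype.piFinset (fun _ : Fin n => box 4 (L / 2))
      · have hzb : ∀ i, z i ∈ box 4 (L / 2) := Fintype.mem_piFinset.1 hz
        have hsep' : ∀ i ∈ S, ∀ i' ∈ S, i ≠ i' → ∃ k : Fin 4, (2 * (R : ℤ) + 4) ≤ |z i k - z i' k| := by
          intro i _ i' _ hii'
          obtain ⟨k, hk⟩ := hsep i i' hii'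
          exact ⟨k, by rwa [valMinAbs_sub_eq_of_mem_box_half (hzb i) (hzb i') k] at hk⟩
        have hWcol : |∫ U, ∏ i ∈ S, (r.curvature.F (configShift (-(z i)) (Ce.lift U)) - μC) ∂(Ce.measure r.ρ β)| ≤
            (6 * C₀ / (R : ℝ) ^ 4) ^ S.card :=
          abs_partialMoment_le_of_strings Ce r β (fun m' q y hq hy hs => H m' q y R hq hR hRa hRL hy hs) S z
            (fun i _ => hzb i) hsep'
        have ha4R : a ^ 4 ≤ ℓ₄ ^ 4 / (R : ℝ) ^ 4 := by
          rw [le_div_iff₀ (by positivity), ← mul_pow]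
          exact pow_le_pow_left₀ (by positivity) (by nlinarith) 4
        have hq1 : ℓ₄ ^ 4 / (R : ℝ) ^ 4 ≤ (6 * C₀ + ℓ₄ ^ 4) / (R : ℝ) ^ 4 :=
          div_le_div_of_nonneg_right (by linarith [mul_nonneg (by norm_num : (0:ℝ) ≤ 6) hC₀]) (by positivity)
        have hq2 : 6 * C₀ / (R : ℝ) ^ 4 ≤ (6 * C₀ + ℓ₄ ^ 4) / (R : ℝ) ^ 4 :=
          div_le_div_of_nonneg_right (by linarith [pow_nonneg hℓ.le 4]) (by positivity)
        simp only [hV, hz, if_true, mul_one]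
        rw [abs_mul, abs_of_pos (pow_pos ha4 _)]
        calc (a ^ 4) ^ (n - S.card) * |∫ U, ∏ i ∈ S, (r.curvature.F (configShift (-(z i)) (Ce.lift U)) - μC) ∂(Ce.measure r.ρ β)|
            ≤ ((6 * C₀ + ℓ₄ ^ 4) / (R : ℝ) ^ 4) ^ (n - S.card) * ((6 * C₀ + ℓ₄ ^ 4) / (R : ℝ) ^ 4) ^ S.card :=
              mul_le_mul (pow_le_pow_left₀ ha4.le (ha4R.trans hq1) _)
                (hWcol.trans (pow_le_pow_left₀ (by positivity) hq2 _)) (abs_nonneg _) (by positivity)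
          _ = ((6 * C₀ + ℓ₄ ^ 4) / (R : ℝ) ^ 4) ^ n := by rw [← pow_add, Nat.sub_add_cancel hS]
      · simp only [hV, hz, if_false, mul_zero, abs_zero]
        positivity
    -- the abstract-weights pointwise bound (toolkit X-b, shift `s = 0`)
    have hpt := abs_weight_mul_norm_le_prod (L := L) (n := n) (s := 0) hℓ hCw hM V hVsup hVcol ha ha1 haℓ hL14 hLa hn
      le_rfl (by norm_num) (by rw [zero_mul]; norm_num) F hF x (fun l => a • siteToE (x l))
      (fun l => by rw [sub_self, norm_zero, zero_mul])
    -- the summable weight is `≤ (2⁶ a⁴)ⁿ`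
    have hprod : ∏ i : Fin n, (2 ^ 6 * (a ^ 4 * ((1 + a * ‖x i‖) ^ 6)⁻¹)) ≤ (2 ^ 6) ^ n * a ^ (4 * n) := by
      calc ∏ i : Fin n, (2 ^ 6 * (a ^ 4 * ((1 + a * ‖x i‖) ^ 6)⁻¹))
          ≤ ∏ _i : Fin n, ((2 : ℝ) ^ 6 * a ^ 4) := Finset.prod_le_prod (fun i _ => by positivity) fun i _ => by
              have h1 : ((1 + a * ‖x i‖) ^ 6)⁻¹ ≤ 1 := by
                apply inv_le_one_of_one_le₀
                exact one_le_pow₀ (by nlinarith [norm_nonneg (x i), ha.le])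
              nlinarith [ha4]
        _ = (2 ^ 6) ^ n * a ^ (4 * n) := by
            rw [Finset.prod_const, Finset.card_univ, Fintype.card_fin, mul_pow, pow_mul]
    -- `V x = (a⁴)^{n−|S|} W S` at our `x ∈ box(L/2)ⁿ`, and `|μC − m|^{n−|S|} ≤ (a⁴)^{n−|S|}` after `hδ`
    have hVx : V x = (a ^ 4) ^ (n - S.card) * W S := by
      simp only [hV, hx, if_true, mul_one, hW]
    have hcoef : |μC - m| ^ (n - S.card) ≤ (a ^ 4) ^ (n - S.card) := by
      apply pow_le_pow_left₀ (abs_nonneg _)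
      have h1 : a ^ 4 * (a⁻¹ ^ 4 * |μC - m|) ≤ a ^ 4 * 1 := mul_le_mul_of_nonneg_left hδ ha4.le
      have h2 : a ^ 4 * a⁻¹ ^ 4 = 1 := by rw [← mul_pow, mul_inv_cancel₀ ha.ne', one_pow]
      calc |μC - m| = a ^ 4 * a⁻¹ ^ 4 * |μC - m| := by rw [h2, one_mul]
        _ = a ^ 4 * (a⁻¹ ^ 4 * |μC - m|) := by ring
        _ ≤ a ^ 4 := by rw [mul_one] at h1; exact h1
    calc |(μC - m) ^ (n - S.card) * W S| * ‖F (fun i => a • siteToE (x i))‖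
        = |μC - m| ^ (n - S.card) * |W S| * ‖F (fun i => a • siteToE (x i))‖ := by rw [abs_mul, abs_pow]
      _ ≤ (a ^ 4) ^ (n - S.card) * |W S| * ‖F (fun i => a • siteToE (x i))‖ := by
          gcongr
      _ = |V x| * ‖F (fun i => a • siteToE (x i))‖ := by rw [hVx, abs_mul, abs_of_pos (pow_pos ha4 _)]
      _ ≤ Kw ^ n * Ssum * ∏ i : Fin n, (2 ^ 6 * (a ^ 4 * ((1 + a * ‖x i‖) ^ 6)⁻¹)) := hpt
      _ ≤ Kw ^ n * Ssum * ((2 ^ 6) ^ n * a ^ (4 * n)) :=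
          mul_le_mul_of_nonneg_left hprod (mul_nonneg (pow_nonneg hKw0 n) hSsum0)
      _ = Kw ^ n * Ssum * (2 ^ 6) ^ n * a ^ (4 * n) := by ring
  -- sum over `S`
  calc |Ce.moment r.ρ β r.curvature.F m x| * ‖F (fun i => a • siteToE (x i))‖
      = |∑ S ∈ (Finset.univ : Finset (Fin n)).powerset, (μC - m) ^ (n - S.card) * W S| *
          ‖F (fun i => a • siteToE (x i))‖ := by rw [hexp]
    _ ≤ (∑ S ∈ (Finset.univ : Finset (Fin n)).powerset, |(μC - m) ^ (n - S.card) * W S|) *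
          ‖F (fun i => a • siteToE (x i))‖ :=
        mul_le_mul_of_nonneg_right (Finset.abs_sum_le_sum_abs _ _) (norm_nonneg _)
    _ = ∑ S ∈ (Finset.univ : Finset (Fin n)).powerset,
          |(μC - m) ^ (n - S.card) * W S| * ‖F (fun i => a • siteToE (x i))‖ := Finset.sum_mul _ _ _
    _ ≤ ∑ _S ∈ (Finset.univ : Finset (Fin n)).powerset, Kw ^ n * Ssum * (2 ^ 6) ^ n * a ^ (4 * n) :=
        Finset.sum_le_sum hterm
    _ = 2 ^ n * (Kw ^ n * Ssum * (2 ^ 6) ^ n) * a ^ (4 * n) := by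
        rw [Finset.sum_const, Finset.card_powerset, Finset.card_univ, Fintype.card_fin, nsmul_eq_mul]
        push_cast
        ring

/-! ## §2 The cover near-diagonal sum at one lattice -/

/-- **Cover near-diagonal sum at one lattice** (§1 + the count of part I). [folklore] -/
theorem cover_near_sum_le (Ce : PeriodCell 4) (r : LatticeRep G) (β : ℝ) {C₀ ℓ₄ B a m δ K : ℝ} {L n : ℕ}
    (hℓ : 0 < ℓ₄) (hC₀ : 0 ≤ C₀) (hB : ∀ V, |r.curvature.F V| ≤ B)
    (ha : 0 < a) (ha1 : a ≤ 1) (haℓ : a ≤ ℓ₄) (haδ : a ≤ δ) (hL14 : 14 ≤ L) (hLa : a⁻¹ * a⁻¹ ≤ L) (hn : 2 ≤ n)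
    (H : ∀ (m' : ℕ) (q : Fin m' → Fin 4 × Fin 4) (y : Fin m' → Site 4) (R : ℕ), (∀ j, (q j).1 < (q j).2) → 1 ≤ R →
      (R : ℝ) * a ≤ ℓ₄ → 4 * R + 8 ≤ L → (∀ j, y j ∈ box 4 (L / 2)) →
      (∀ j j' : Fin m', j ≠ j' → ∃ k : Fin 4, (2 * (R : ℤ) + 4) ≤ |y j k - y j' k|) →
      |stateMomentStr G r (Measure.map Ce.lift (Ce.measure r.ρ β)) m' q y| ≤ (C₀ / (R : ℝ) ^ 4) ^ m')
    (F : 𝓢((Fin n → EuclideanSpace ℝ (Fin 4)), ℂ)) (hF : IsOffDiagonal F)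
    (hsupp : ∀ x : Fin n → Site 4, (∃ i, x i ∉ box 4 (L / 2)) → F (fun i => a • siteToE (x i)) = 0)
    (hK : 0 ≤ K) (hFK : tsupport (F : (Fin n → EuclideanSpace ℝ (Fin 4)) → ℂ) ⊆ Metric.closedBall 0 K)
    (hδ : a⁻¹ ^ 4 * |Ce.mean r.ρ β r.curvature.F - m| ≤ 1) :
    ∑ x ∈ Fintype.piFinset (fun _ : Fin n => box 4 L),
        (if (∃ i j : Fin n, i ≠ j ∧ ∀ l : Fin 4, a * |((x i l - x j l : ℤ) : ℝ)| < δ) then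
          |Ce.moment r.ρ β r.curvature.F m x| * ‖F (fun i => a • siteToE (x i))‖ else 0) ≤
      2 ^ n * (((2 * B + 1) * 4 ^ 4 * 5 ^ 6 + (2 * B + 1) * 2 ^ 6 * (10 + 2 * 0) ^ 4 +
            16 * (6 * C₀ + ℓ₄ ^ 4) * 2 ^ 6 * (2 / ℓ₄ + 48) ^ 4) ^ n *
          (SchwartzMap.seminorm ℂ 0 (4 * n) F + SchwartzMap.seminorm ℂ (6 * n) (4 * n) F +
            SchwartzMap.seminorm ℂ 0 0 F + SchwartzMap.seminorm ℂ (6 * n) 0 F + SchwartzMap.seminorm ℂ (10 * n) 0 F) *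
          (2 ^ 6) ^ n) *
        ((n : ℝ) ^ 2 * (2 * K + 1) ^ (4 * (n - 1)) * (3 * δ) ^ 4) := by
  have hB0 : 0 ≤ B := (abs_nonneg _).trans (hB 1)
  refine near_sum_le hn (fun x => Ce.moment r.ρ β r.curvature.F m x) (fun x => ‖F (fun i => a • siteToE (x i))‖)
    (fun x => norm_nonneg _) ha ha1 haδ hK (by positivity) ?_ ?_ L
  · intro x
    exact cover_pointwise_le Ce r β hℓ hC₀ hB ha ha1 haℓ hL14 hLa hn H F hF hsupp hδ x
  · rintro x ⟨i, hi⟩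
    have h1 : K < ‖(fun i => a • siteToE (x i)) i‖ := hi.trans_le (mul_norm_le_norm_smul_siteToE ha.le (x i))
    have h2 : F (fun i => a • siteToE (x i)) = 0 := by
      refine image_eq_zero_of_notMem_tsupport fun hmem => ?_
      have h := hFK hmem
      rw [mem_closedBall_zero_iff] at h
      linarith [norm_le_pi_norm (fun i => a • siteToE (x i)) i]
    change ‖F (fun i => a • siteToE (x i))‖ = 0
    rw [h2, norm_zero]

/-! ## §3–§4 Along a leg scheme: the cover clause, and the crux from `OnePointRate ∧ CoverMomentBounds6` -/

/-- ★ **`NearDiagonalVanishing ⇐ OnePointRate ∧ CoverMomentBounds6`.**  The cover clause of the crux along the leg scheme — `OnePointRate`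
makes `a_k⁻⁴|m_C(k) − m_T(k)| ≤ 1` eventually, `CoverMomentBounds6` supplies the cell strings ceiling on `C_k` for `β_k ≥ β₄`, compact
support gives both support conditions, and §2 bounds the near-diagonal sum by `A·δ⁴ ≤ A·δ ≤ ε` for `δ := min 1 (ε/(A+1))` — fed to
part II's reduction `nearDiagonalVanishing_of_coverHalf` (torus clause already proved there). [folklore] -/
theorem nearDiagonalVanishing_of_rate
    (h1 : Summit.QuantumFields.YangMills.Theses.RecentredCoverTransfer.OnePointRate)
    (h6 : Summit.QuantumFields.YangMills.Theses.RecentredCoverTransfer.CoverMomentBounds6) :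
    Summit.QuantumFields.YangMills.Theses.RecentredCoverTransfer.NearDiagonalVanishing := by
  classical
  refine nearDiagonalVanishing_of_coverHalf ?_
  intro G _ _ _ _ hG
  letI : MeasurableSpace G := borel G
  haveI : BorelSpace G := ⟨rfl⟩
  intro r a ha ha0 hMB sch hsch C hC n hn F hF hFc ε hε
  have hΔ := h1 G hG r a ha ha0 hMB sch hsch C hC
  obtain ⟨C₀, β₄, ℓ₄, hℓ, hC₀, H6⟩ := h6 G hG r a ha ha0 hMB
  obtain ⟨B, hB⟩ := r.curvature.bounded
  have hB0 : 0 ≤ B := (abs_nonneg _).trans (hB 1)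
  obtain ⟨hsa, hβ, hk⟩ := hsch
  -- support radius
  obtain ⟨KF, hKF⟩ := (Metric.isBounded_iff_subset_closedBall (0 : Fin n → EuclideanSpace ℝ (Fin 4))).1
    hFc.isCompact.isBounded
  set K : ℝ := max KF 0 with hKdef
  have hK : 0 ≤ K := le_max_right _ _
  have hFK : tsupport (F : (Fin n → EuclideanSpace ℝ (Fin 4)) → ℂ) ⊆ Metric.closedBall 0 K :=
    hKF.trans (Metric.closedBall_subset_closedBall (le_max_left _ _))
  -- constants
  set Kw : ℝ := (2 * B + 1) * 4 ^ 4 * 5 ^ 6 + (2 * B + 1) * 2 ^ 6 * (10 + 2 * 0) ^ 4 +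
    16 * (6 * C₀ + ℓ₄ ^ 4) * 2 ^ 6 * (2 / ℓ₄ + 48) ^ 4 with hKw
  set Ssum : ℝ := SchwartzMap.seminorm ℂ 0 (4 * n) F + SchwartzMap.seminorm ℂ (6 * n) (4 * n) F +
    SchwartzMap.seminorm ℂ 0 0 F + SchwartzMap.seminorm ℂ (6 * n) 0 F + SchwartzMap.seminorm ℂ (10 * n) 0 F with hSsum
  have hKw0 : 0 ≤ Kw := by rw [hKw]; positivity
  have hSsum0 : 0 ≤ Ssum := by rw [hSsum]; positivity
  set A : ℝ := 2 ^ n * (Kw ^ n * Ssum * (2 ^ 6) ^ n) * ((n : ℝ) ^ 2 * (2 * K + 1) ^ (4 * (n - 1)) * 3 ^ 4) with hA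
  have hA0 : 0 ≤ A := by rw [hA]; positivity
  set δ : ℝ := min 1 (ε / (A + 1)) with hδdef
  have hδ0 : 0 < δ := lt_min one_pos (div_pos hε (by linarith))
  have hδ1 : δ ≤ 1 := min_le_left _ _
  have hδε : A * δ ≤ ε := by
    have h1 : δ ≤ ε / (A + 1) := min_le_right _ _
    have h2 : A * δ ≤ A * (ε / (A + 1)) := mul_le_mul_of_nonneg_left h1 hA0
    have h3 : A * (ε / (A + 1)) ≤ ε := by
      rw [mul_div_assoc', div_le_iff₀ (by linarith)]
      nlinarith
    exact h2.trans h3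
  refine ⟨δ, hδ0, ?_⟩
  -- eventual conditions along the scheme
  have hEℓδ : ∀ᶠ k in atTop, sch.a k < min ℓ₄ δ := sch.tendsto_a.eventually_lt_const (lt_min hℓ hδ0)
  have hEβ : ∀ᶠ k in atTop, β₄ ≤ sch.β k := hβ.eventually_ge_atTop β₄
  have hEsupp := eventually_apply_eq_zero_of_not_mem_box sch F hFc
  have hEone : ∀ᶠ k in atTop, (sch.a k)⁻¹ ^ 4 *
      |(C k).mean r.ρ (sch.β k) r.curvature.F - wilsonTorusMean r.ρ (sch.β k) (sch.L k) r.curvature.F| ≤ 1 := by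
    have h := hΔ.norm
    rw [norm_zero] at h
    have h' : Tendsto (fun k => (sch.a k)⁻¹ ^ 4 *
        |(C k).mean r.ρ (sch.β k) r.curvature.F - wilsonTorusMean r.ρ (sch.β k) (sch.L k) r.curvature.F|) atTop (𝓝 0) := by
      refine h.congr fun k => ?_
      rw [Real.norm_eq_abs, abs_mul, abs_of_pos (pow_pos (inv_pos.2 (sch.a_pos k)) 4), abs_sub_comm]
    exact (h'.eventually_lt_const one_pos).mono fun k hk => hk.le
  filter_upwards [hEℓδ, hEβ, hEsupp, hEone] with k hkℓδ hkβ hksupp hkone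
  obtain ⟨-, hk24, hk14, hkL⟩ := hk k
  have hakpos : 0 < sch.a k := sch.a_pos k
  have hk1 : sch.a k ≤ 1 := hk24.trans (by norm_num)
  have hkℓ : sch.a k ≤ ℓ₄ := hkℓδ.le.trans (min_le_left _ _)
  have hkδ : sch.a k ≤ δ := hkℓδ.le.trans (min_le_right _ _)
  -- the cell strings ceiling at `C_k`, read at the spacing `a_k = a(β_k)`
  have Hk : ∀ (m' : ℕ) (q : Fin m' → Fin 4 × Fin 4) (y : Fin m' → Site 4) (R : ℕ), (∀ j, (q j).1 < (q j).2) → 1 ≤ R →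
      (R : ℝ) * sch.a k ≤ ℓ₄ → 4 * R + 8 ≤ sch.L k → (∀ j, y j ∈ box 4 (sch.L k / 2)) →
      (∀ j j' : Fin m', j ≠ j' → ∃ k' : Fin 4, (2 * (R : ℤ) + 4) ≤ |y j k' - y j' k'|) →
      |stateMomentStr G r (Measure.map (C k).lift ((C k).measure r.ρ (sch.β k))) m' q y| ≤ (C₀ / (R : ℝ) ^ 4) ^ m' :=
    fun m' q y R hq hR hRa hRL hy hs =>
      H6 (sch.β k) hkβ (C k) (sch.L k) (hC k) m' q y R hq hR (by rw [← hsa k]; exact hRa) hRL hy hs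
  have hmain := cover_near_sum_le (C k) r (sch.β k) hℓ hC₀ hB hakpos hk1 hkℓ hkδ hk14 hkL hn Hk F hF hksupp hK hFK hkone
  refine hmain.trans ?_
  have hδ4 : (3 * δ) ^ 4 = 3 ^ 4 * δ ^ 4 := by ring
  have hδpow : δ ^ 4 ≤ δ := by
    have := pow_le_pow_of_le_one hδ0.le hδ1 (show 1 ≤ 4 by norm_num)
    rwa [pow_one] at this
  calc 2 ^ n * (Kw ^ n * Ssum * (2 ^ 6) ^ n) * ((n : ℝ) ^ 2 * (2 * K + 1) ^ (4 * (n - 1)) * (3 * δ) ^ 4)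
      = A * δ ^ 4 := by rw [hδ4, hA]; ring
    _ ≤ A * δ := mul_le_mul_of_nonneg_left hδpow hA0
    _ ≤ ε := hδε

end Summit.QuantumFields.YangMills.Theorems.RecentredCoverTransfer.NearDiagonal

end
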